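import Literature.Probability.Percolation.ArmSeparationExtSlotDefs
import Literature.Probability.Percolation.ArmSeparationFourArmProofs
import HarnessLib

/-!
# Outer slots: monotonicity, supports and locality of the four events

Topic: Probability / Percolation; family `crit-perc`. A brick of the discharge of
`Literature.Probability.Percolation.Nolin2008_twoArm_separation` (Nolin 2008, Thm. 11
[arXiv 0711.4948: Thm. 10]; `ArmSeparation.lean`), landing of the EXTERNAL extremities (mirror of
`ArmSeparationSlotEvents.lean`), preparing the generalised FKG inequality (Nolin's Lemma 13
[arXiv Lemma 12], `triSitePercolation_locallyMonotone_fkg`) for the four events of an outer slot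
(`ArmSeparationExtSlotDefs.lean`):

* transport of fenced outer tips (`trapTipOK_mono`, `trapTipOK_congr`, `TrapFencedArm.mapMono`,
  `TrapFencedArm.congr`); the colour-exchanged frame of the closed arm
  (`rotConfig_ic'_negFlip`: `rotConfig ((i+3) % 6) (negFlip ω) = (rotConfig i ω)ᶜ`);
* monotonicity: `ESlot.isUpperSet_blackArm`, `ESlot.isLowerSet_whiteArm`,
  `isUpperSet_extCorrEvent`, `ESlot.isUpperSet_blackCorr`, `ESlot.isLowerSet_whiteCorr`;
* supports: the slot frame box `eslotFrame M k T₀ w = [2M+1, 2M+2k+1] × [T₀+1, T₀+w+2k]`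
  (exterior sites of the fence zones and corner boxes of all tips of the window), the shared
  support `triBall (2M)`, the corridor support `ecorrFin` and the private supports `ESlot.Pfin`,
  `ESlot.Mfin`;
* locality: `determinedBy_extCorrEvent`, `ESlot.determinedBy_blackCorr`,
  `ESlot.determinedBy_whiteCorr`, `ESlot.determinedBy_blackArm`, `ESlot.determinedBy_whiteArm`.

## References

* P. Nolin, *Near-critical percolation in two dimensions*, Electron. J. Probab. 13 (2008), §4.3
  Lemma 13, §4.4 [arXiv 0711.4948: Lemma 12, Thm. 10]. [Nolin2008]
-/

noncomputable section

open Set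

namespace Literature.Probability.Percolation

open LatticeModels Tube

/-! ### Transport of fenced outer tips -/

/-- A fenced outer tip stays fenced when sites open. [folklore] -/
theorem trapTipOK_mono {M k : ℕ} {z m : Site 2} {χ χ' : SiteConfig (Site 2)} (h : χ ≤ χ') (hT : TrapTipOK M z k χ m) :
    TrapTipOK M z k χ' m := by
  obtain ⟨⟨bb, tt, hbb, htt, P1, P2⟩, hprot⟩ := hT
  refine ⟨⟨bb, tt, hbb, htt, P1.mono fun _ hv => ⟨hv.1, h hv.2⟩, P2.mono fun _ hv => ⟨hv.1, h hv.2⟩⟩, fun q t hq hqb ht hp => ?_⟩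
  exact hprot q t hq hqb ht (hp.mono fun _ hv => ⟨hv.1, fun hv' => hv.2 (h hv')⟩)

/-- A fenced outer tip is a property of the configuration on the corner box and on the trapezoid. [folklore] -/
theorem trapTipOK_congr {M k : ℕ} {z m : Site 2} {χ χ' : SiteConfig (Site 2)}
    (h : ∀ v ∈ triStrip (z 0 + k) (z 1 + k) k k ∪ ↑(trapD M), v ∈ χ ↔ v ∈ χ') (hT : TrapTipOK M z k χ m) :
    TrapTipOK M z k χ' m := by
  obtain ⟨⟨bb, tt, hbb, htt, P1, P2⟩, hprot⟩ := hT
  refine ⟨⟨bb, tt, hbb, htt, P1.mono fun v hv => ⟨hv.1, (h v (Or.inl hv.1)).1 hv.2⟩,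
    P2.mono fun v hv => ⟨hv.1, (h v (Or.inl hv.1)).1 hv.2⟩⟩, fun q t hq hqb ht hp => ?_⟩
  exact hprot q t hq hqb ht (hp.mono fun v hv => ⟨hv.1, fun hv' => hv.2 ((h v (Or.inr hv.1)).1 hv')⟩)

namespace TrapFencedArm

variable {M n k₀ K : ℕ} {χ χ' : SiteConfig (Site 2)}

/-- **Opening sites keeps a fenced arm** (same data). [folklore] -/
def mapMono (h : χ ≤ χ') (F : TrapFencedArm M n k₀ K χ) : TrapFencedArm M n k₀ K χ' where
  z := F.z
  j := F.j
  m := F.m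
  a := F.a
  z_mem := F.z_mem
  j_lt := F.j_lt
  norm_a := F.norm_a
  tipOK := trapTipOK_mono h F.tipOK
  path := F.path.mono fun _ hv => ⟨hv.1, h hv.2⟩
  path_tip := F.path_tip.mono fun _ hv => ⟨hv.1, h hv.2⟩

/-- The sites read by a fenced arm: annulus, fence zone, corner box and trapezoid. [folklore] -/
def reads (F : TrapFencedArm M n k₀ K χ) : Set (Site 2) :=
  triAnnSet n (2 * M) ∪ trapFrameZone M F.z F.k ∪ triStrip (F.z 0 + F.k) (F.z 1 + F.k) F.k F.k ∪ ↑(trapD M)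

/-- **A fenced arm is a property of the configuration on the sites it reads.** [folklore] -/
def congr (F : TrapFencedArm M n k₀ K χ) (h : ∀ v ∈ F.reads, v ∈ χ ↔ v ∈ χ') : TrapFencedArm M n k₀ K χ' where
  z := F.z
  j := F.j
  m := F.m
  a := F.a
  z_mem := F.z_mem
  j_lt := F.j_lt
  norm_a := F.norm_a
  tipOK := trapTipOK_congr (fun v hv => h v (hv.elim (fun hv => Or.inl (Or.inr hv)) fun hv => Or.inr hv)) F.tipOK
  path := F.path.mono fun v hv => ⟨hv.1, (h v (Or.inl (Or.inl hv.1))).1 hv.2⟩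
  path_tip := F.path_tip.mono fun v hv => ⟨hv.1, (h v (Or.inl (Or.inl (Or.inl hv.1)))).1 hv.2⟩

/-- `mapMono` keeps the data. [folklore] -/
@[simp] theorem mapMono_data (h : χ ≤ χ') (F : TrapFencedArm M n k₀ K χ) :
    (F.mapMono h).z = F.z ∧ (F.mapMono h).j = F.j ∧ (F.mapMono h).a = F.a := ⟨rfl, rfl, rfl⟩

/-- `congr` keeps the data. [folklore] -/
@[simp] theorem congr_data (F : TrapFencedArm M n k₀ K χ) (h : ∀ v ∈ F.reads, v ∈ χ ↔ v ∈ χ') :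
    (F.congr h).z = F.z ∧ (F.congr h).j = F.j ∧ (F.congr h).a = F.a := ⟨rfl, rfl, rfl⟩

/-- Transport along an equality of configurations. [folklore] -/
def cast (F : TrapFencedArm M n k₀ K χ) (h : χ = χ') : TrapFencedArm M n k₀ K χ' := F.congr fun v _ => by rw [h]

/-- `cast` keeps the data. [folklore] -/
@[simp] theorem cast_data (F : TrapFencedArm M n k₀ K χ) (h : χ = χ') :
    (F.cast h).z = F.z ∧ (F.cast h).j = F.j ∧ (F.cast h).a = F.a := ⟨rfl, rfl, rfl⟩

end TrapFencedArm

/-- **The colour-exchanged frame of the closed arm**: `rotConfig ((i+3) % 6) (negFlip ω) = (rotConfig i ω)ᶜ`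
— the closed arm of `ω` behind side `i` is an open arm of `negFlip ω` behind side `i + 3`. [folklore] -/
theorem rotConfig_ic'_negFlip (i : ℕ) (ω : SiteConfig (Site 2)) : rotConfig ((i + 3) % 6) (negFlip ω) = (rotConfig i ω)ᶜ := by
  ext v
  rw [mem_rotConfig, triRotIsoPow_mod_six_apply, mem_negFlip, Set.mem_compl_iff, mem_rotConfig,
    ← triRotIsoPow_three_apply, ← triRotIsoPow_add_apply, show i + 3 + 3 = i + 6 by ring, triRotIsoPow_add_six_apply]

/-! ### Monotonicity -/

/-- Complementing a rotated frame is antitone. [folklore] -/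
theorem compl_rotConfig_anti (i : ℕ) {ω ω' : SiteConfig (Site 2)} (h : ω ≤ ω') : (rotConfig i ω')ᶜ ≤ (rotConfig i ω)ᶜ :=
  Set.compl_subset_compl.2 (rotConfig_mono i h)

namespace ESlot

variable (P : EParams) (σ : ESlot)

/-- **The open arm event of a slot is increasing.** [folklore] -/
theorem isUpperSet_blackArm : IsUpperSet (σ.blackArm P) := by
  rintro ω ω' hle ⟨F, hj, h1, h2, hg⟩
  exact ⟨F.mapMono (rotConfig_mono σ.io hle), hj, h1, h2, hg⟩

/-- **The closed arm event of a slot is decreasing.** [folklore] -/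
theorem isLowerSet_whiteArm : IsLowerSet (σ.whiteArm P) := by
  rintro ω ω' hle ⟨F, hj, h1, h2, hg⟩
  exact ⟨F.mapMono (compl_rotConfig_anti σ.ic hle), hj, h1, h2, hg⟩

end ESlot

/-- **The corridor event is increasing.** [folklore] -/
theorem isUpperSet_extCorrEvent (i M N k : ℕ) (T₀ : ℤ) (w L ε r e s a len : ℕ) (t : ℤ) (W H : ℕ) :
    IsUpperSet (extCorrEvent i M N k T₀ w L ε r e s a len t W H) :=
  (((((isUpperSet_extSpokeEvent i M k T₀ w L ε).inter (isUpperSet_eventAll _)).inter (isUpperSet_triHCross _ _ _ _)).inter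
    (isUpperSet_triVCross _ _ _ _)).inter (isUpperSet_triHCross _ _ _ _)).inter (isUpperSet_triVCross _ _ _ _)

namespace ESlot

variable (P : EParams) (σ : ESlot)

/-- The corridor of the open arm is increasing. [folklore] -/
theorem isUpperSet_blackCorr : IsUpperSet (σ.blackCorr P) := isUpperSet_extCorrEvent _ _ _ _ _ _ _ _ _ _ _ _ _ _ _ _

/-- The corridor of the closed arm is decreasing. [folklore] -/
theorem isLowerSet_whiteCorr : IsLowerSet (σ.whiteCorr P) :=
  IsUpperSet.preimage_negFlip (isUpperSet_extCorrEvent _ _ _ _ _ _ _ _ _ _ _ _ _ _ _ _)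

end ESlot

/-! ### Supports -/

/-- **The slot frame box** (tip's frame): `[2M+1, 2M+2k+1] × [T₀+1, T₀+w+2k]`, containing the
exterior sites of the fence zone and the corner box of every tip of scale `k` with row in
`[T₀, T₀+w)`. [cite: Nolin2008, §4.2 Def. 6 (free spaces) (arXiv 0711.4948)] -/
def eslotFrame (M k : ℕ) (T₀ : ℤ) (w : ℕ) : Finset (Site 2) := triStripFinset (2 * (M : ℤ) + 1) (T₀ + 1) (2 * k) (w + 2 * k - 1)

/-- Membership in the slot frame box (`1 ≤ w`). [folklore] -/
theorem mem_eslotFrame {M k : ℕ} {T₀ : ℤ} {w : ℕ} (hw : 1 ≤ w) {v : Site 2} :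
    v ∈ eslotFrame M k T₀ w ↔ 2 * (M : ℤ) + 1 ≤ v 0 ∧ v 0 ≤ 2 * (M : ℤ) + 2 * k + 1 ∧ T₀ + 1 ≤ v 1 ∧ v 1 ≤ T₀ + w + 2 * k := by
  rw [eslotFrame, ← Finset.mem_coe, coe_triStripFinset, mem_triStrip]
  have : ((w + 2 * k - 1 : ℕ) : ℤ) = (w : ℤ) + 2 * k - 1 := by omega
  rw [this]; push_cast; omega

/-- **The support of a corridor**: `ρ^i` of the spoke's box, the sites of the arc and the four
landing boxes. [cite: Nolin2008, §4.3 Lemma 13 (arXiv 0711.4948: Lemma 12, the sets `𝒜^±`)] -/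
def ecorrFin (i M N k : ℕ) (T₀ : ℤ) (w L ε r e s a len : ℕ) (t : ℤ) (W H : ℕ) : Finset (Site 2) :=
  (extSpokeTube M k T₀ w L ε).sites.image (triRotIsoPow i) ∪ sitesAll (arc (thinRing r e s) a len) ∪
    triStripFinset ((r : ℤ) - e - 1) t W (r / 64) ∪
    triStripFinset ((N : ℤ) - (N / 8 : ℕ)) (-((N / 2 : ℕ) : ℤ) - (N / 64 : ℕ)) (N / 8 - 1) H ∪
    triStripFinset ((N : ℤ) - (N / 8 : ℕ)) (-((N / 2 : ℕ) : ℤ) - (N / 64 : ℕ) + 1) (2 * (N / 8) - 1) (N / 64 - 1) ∪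
    triStripFinset ((N : ℤ) + 2) (-((N / 2 : ℕ) : ℤ) - (N / 64 : ℕ)) (N / 8 - 3) (2 * (N / 64))

namespace ESlot

variable (P : EParams) (σ : ESlot)

/-- **The private support of the open arm of the slot**: the framed slot box and the corridor support. [cite: Nolin2008, §4.3 Lemma 13 (arXiv 0711.4948: Lemma 12)] -/
def Pfin : Finset (Site 2) :=
  (eslotFrame P.M (σ.ko P) (σ.To P) P.w).image (triRotIsoPow σ.io) ∪
    ecorrFin σ.io P.M P.N (σ.ko P) (σ.To P) (σ.wo P) (P.LB - σ.ko P) P.ε P.rB P.e P.s (σ.aB P) P.lenB (σ.tgo P) P.WB (σ.HB P)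

/-- **The private support of the closed arm of the slot** (framed box, and the reflection of the
support of its corridor in the colour-exchanged picture). [cite: Nolin2008, §4.3 Lemma 13 (arXiv 0711.4948: Lemma 12)] -/
def Mfin : Finset (Site 2) :=
  (eslotFrame P.M (σ.kc P) (σ.Tc P) P.w).image (triRotIsoPow σ.ic) ∪
    (ecorrFin σ.ic' P.M P.N (σ.kc P) (σ.Tc P) (σ.wc P) (P.LW - σ.kc P) P.ε P.rW P.e P.s (σ.aW P) (σ.lenW P) (σ.tgc P) P.WW
      (σ.HW P)).image Neg.neg

end ESlot

/-! ### The corridors are determined by their supports -/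

/-- **The corridor event is determined by its support.** [folklore] -/
theorem determinedBy_extCorrEvent (i M N k : ℕ) (T₀ : ℤ) (w L ε r e s a len : ℕ) (t : ℤ) (W H : ℕ) :
    DeterminedBy (extCorrEvent i M N k T₀ w L ε r e s a len t W H) ↑(ecorrFin i M N k T₀ w L ε r e s a len t W H) := by
  unfold extCorrEvent ecorrFin extE2 extE3 extE4 extE5
  have d1 := determinedBy_extSpokeEvent i M k T₀ w L ε
  have d2 := determinedBy_eventAll (arc (thinRing r e s) a len)
  have d3 := determinedBy_triHCross ((r : ℤ) - e - 1) t W (r / 64)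
  have d4 := determinedBy_triVCross ((N : ℤ) - (N / 8 : ℕ)) (-((N / 2 : ℕ) : ℤ) - (N / 64 : ℕ)) (N / 8 - 1) H
  have d5 := determinedBy_triHCross ((N : ℤ) - (N / 8 : ℕ)) (-((N / 2 : ℕ) : ℤ) - (N / 64 : ℕ) + 1) (2 * (N / 8) - 1) (N / 64 - 1)
  have d6 := determinedBy_triVCross ((N : ℤ) + 2) (-((N / 2 : ℕ) : ℤ) - (N / 64 : ℕ)) (N / 8 - 3) (2 * (N / 64))
  refine (((((d1.mono ?_).inter (d2.mono ?_)).inter (d3.mono ?_)).inter (d4.mono ?_)).inter (d5.mono ?_)).inter (d6.mono ?_) <;>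
    intro v hv <;> simp only [Finset.coe_union, Set.mem_union, Finset.coe_image]
  · obtain ⟨u, hu, rfl⟩ := hv
    refine Or.inl (Or.inl (Or.inl (Or.inl (Or.inl ⟨u, ?_, rfl⟩))))
    rw [coe_sites]; exact hu
  · exact Or.inl (Or.inl (Or.inl (Or.inl (Or.inr hv))))
  · exact Or.inl (Or.inl (Or.inl (Or.inr hv)))
  · exact Or.inl (Or.inl (Or.inr hv))
  · exact Or.inl (Or.inr hv)
  · exact Or.inr hv

namespace ESlot

variable (P : EParams) (σ : ESlot)

/-- The corridor support is part of the private support. [folklore] -/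
theorem ecorrFin_subset_Pfin :
    ecorrFin σ.io P.M P.N (σ.ko P) (σ.To P) (σ.wo P) (P.LB - σ.ko P) P.ε P.rB P.e P.s (σ.aB P) P.lenB (σ.tgo P) P.WB (σ.HB P) ⊆ σ.Pfin P :=
  Finset.subset_union_right

/-- **The corridor of the open arm is determined by the private support `Pfin`.** [folklore] -/
theorem determinedBy_blackCorr : DeterminedBy (σ.blackCorr P) ↑(σ.Pfin P) :=
  (determinedBy_extCorrEvent _ _ _ _ _ _ _ _ _ _ _ _ _ _ _ _).mono (Finset.coe_subset.2 (ecorrFin_subset_Pfin P σ))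

/-- **The corridor of the closed arm is determined by the private support `Mfin`.** [folklore] -/
theorem determinedBy_whiteCorr : DeterminedBy (σ.whiteCorr P) ↑(σ.Mfin P) := by
  unfold whiteCorr Mfin
  have h := DeterminedBy.preimage_negFlip (determinedBy_extCorrEvent σ.ic' P.M P.N (σ.kc P) (σ.Tc P) (σ.wc P) (P.LW - σ.kc P) P.ε
    P.rW P.e P.s (σ.aW P) (σ.lenW P) (σ.tgc P) P.WW (σ.HW P))
  refine h.mono ?_
  intro v hv
  rw [Finset.coe_union, Finset.coe_image, Finset.coe_image]
  exact Or.inr ⟨-v, hv, neg_neg v⟩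

end ESlot

/-! ### The arm events are determined by the shared support and the framed slot boxes -/

/-- The sites read by a fenced arm of scale `k` with tip row in `[T₀, T₀+w)`, away from the
corners, are in the ball `Λ_{2M}` or in the slot frame box (`1 ≤ w`, `1 ≤ k`, `R₀ ≥ 2k + 2`). [folklore] -/
theorem TrapFencedArm.reads_subset {M n k₀ K : ℕ} {χ : SiteConfig (Site 2)} (F : TrapFencedArm M n k₀ K χ) {T₀ : ℤ} {w R₀ : ℕ}
    (hw : 1 ≤ w) (hk : 1 ≤ F.k) (hwin : T₀ ≤ F.z 1 ∧ F.z 1 < T₀ + w) (hg : GoodTip M R₀ F.z) (hR : 2 * F.k + 2 ≤ R₀) :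
    F.reads ⊆ ↑(triBall (2 * M)) ∪ ↑(eslotFrame M F.k T₀ w) := by
  obtain ⟨hz0, hz1, hz1'⟩ := trapO_coord F.z_mem
  have hR' : 2 * (F.k : ℤ) + 2 ≤ R₀ := by exact_mod_cast hR
  have hk' : (1 : ℤ) ≤ F.k := by exact_mod_cast hk
  unfold GoodTip at hg
  intro v hv
  rcases hv with ((hv | hv) | hv) | hv
  · left; rw [Finset.mem_coe, mem_triBall_iff]; exact (mem_triAnnSet.1 hv).2
  · rw [mem_trapFrameZone] at hv
    obtain ⟨h1, h2, h3, h4, h5⟩ := hv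
    rcases h1 with h1 | ⟨h1, h1'⟩
    · left; rw [Finset.mem_coe, mem_triBall_iff]; exact (mem_trapD_iff_triNorm.1 h1).2
    · right
      rw [Finset.mem_coe, mem_eslotFrame hw]
      have hge := (lt_triNorm_iff_lin (x := v) (ρ := 2 * (M : ℤ))).1 h1
      refine ⟨?_, by omega, by omega, by omega⟩
      omega
  · right
    rw [mem_triStrip] at hv
    rw [Finset.mem_coe, mem_eslotFrame hw]
    omega
  · left; rw [Finset.mem_coe, mem_triBall_iff]; exact (mem_trapD_iff_triNorm.1 hv).2

namespace ESlot

variable (P : EParams) (σ : ESlot)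

/-- **Agreement on the shared support and on the framed slot box transports the open arm of a
slot** (`1 ≤ w`, `1 ≤ k₀`, `2 k_o + 2 ≤ R₀`). [folklore] -/
theorem blackArm_of_agree (hw : 1 ≤ P.w) (hk₀ : 1 ≤ P.k₀) (hR : 2 * σ.ko P + 2 ≤ P.R₀) {ω ω' : SiteConfig (Site 2)}
    (h : ∀ v ∈ (↑(triBall (2 * P.M)) : Set (Site 2)) ∪ triRotIsoPow σ.io '' ↑(eslotFrame P.M (σ.ko P) (σ.To P) P.w), v ∈ ω ↔ v ∈ ω')
    (hω : ω ∈ σ.blackArm P) : ω' ∈ σ.blackArm P := by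
  obtain ⟨F, hj, h1, h2, hg⟩ := hω
  have hko : F.k = σ.ko P := by show trapScale P.k₀ F.j = trapScale P.k₀ σ.jo; rw [hj]
  have hsub := F.reads_subset hw (one_le_trapScale hk₀ _) ⟨h1, h2⟩ hg (by rw [hko]; exact hR)
  refine ⟨F.congr fun u hu => ?_, hj, h1, h2, hg⟩
  rw [mem_rotConfig, mem_rotConfig]
  apply h
  rcases hsub hu with hu' | hu'
  · left
    rw [Finset.mem_coe, mem_triBall_iff, triNorm_rot]
    exact mem_triBall_iff.1 hu'
  · right; rw [← hko]; exact ⟨u, hu', rfl⟩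

/-- **The open arm event of a slot is determined by the shared support and the framed slot box.** [cite: Nolin2008, §4.3 Lemma 13 (arXiv 0711.4948: Lemma 12)] -/
theorem determinedBy_blackArm (hw : 1 ≤ P.w) (hk₀ : 1 ≤ P.k₀) (hR : 2 * σ.ko P + 2 ≤ P.R₀) :
    DeterminedBy (σ.blackArm P) ((↑(triBall (2 * P.M)) : Set (Site 2)) ∪ triRotIsoPow σ.io '' ↑(eslotFrame P.M (σ.ko P) (σ.To P) P.w)) := by
  rw [determinedBy_iff]
  intro ω ω' hω
  have h : ∀ v ∈ (↑(triBall (2 * P.M)) : Set (Site 2)) ∪ triRotIsoPow σ.io '' ↑(eslotFrame P.M (σ.ko P) (σ.To P) P.w),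
      v ∈ ω ↔ v ∈ ω' := fun v hv => by
    constructor
    · intro hvω; have : v ∈ ω ∩ _ := ⟨hvω, hv⟩; rw [hω] at this; exact this.1
    · intro hvω; have : v ∈ ω' ∩ _ := ⟨hvω, hv⟩; rw [← hω] at this; exact this.1
  exact ⟨blackArm_of_agree P σ hw hk₀ hR h, blackArm_of_agree P σ hw hk₀ hR fun v hv => (h v hv).symm⟩

/-- **Agreement on the shared support and on the framed slot box transports the closed arm of a slot.** [folklore] -/
theorem whiteArm_of_agree (hw : 1 ≤ P.w) (hk₀ : 1 ≤ P.k₀) (hR : 2 * σ.kc P + 2 ≤ P.R₀) {ω ω' : SiteConfig (Site 2)}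
    (h : ∀ v ∈ (↑(triBall (2 * P.M)) : Set (Site 2)) ∪ triRotIsoPow σ.ic '' ↑(eslotFrame P.M (σ.kc P) (σ.Tc P) P.w), v ∈ ω ↔ v ∈ ω')
    (hω : ω ∈ σ.whiteArm P) : ω' ∈ σ.whiteArm P := by
  obtain ⟨F, hj, h1, h2, hg⟩ := hω
  have hkc : F.k = σ.kc P := by show trapScale P.k₀ F.j = trapScale P.k₀ σ.jc; rw [hj]
  have hsub := F.reads_subset hw (one_le_trapScale hk₀ _) ⟨h1, h2⟩ hg (by rw [hkc]; exact hR)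
  refine ⟨F.congr fun u hu => ?_, hj, h1, h2, hg⟩
  rw [Set.mem_compl_iff, Set.mem_compl_iff, mem_rotConfig, mem_rotConfig, not_iff_not]
  apply h
  rcases hsub hu with hu' | hu'
  · left
    rw [Finset.mem_coe, mem_triBall_iff, triNorm_rot]
    exact mem_triBall_iff.1 hu'
  · right; rw [← hkc]; exact ⟨u, hu', rfl⟩

/-- **The closed arm event of a slot is determined by the shared support and the framed slot box.** [cite: Nolin2008, §4.3 Lemma 13 (arXiv 0711.4948: Lemma 12)] -/
theorem determinedBy_whiteArm (hw : 1 ≤ P.w) (hk₀ : 1 ≤ P.k₀) (hR : 2 * σ.kc P + 2 ≤ P.R₀) :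
    DeterminedBy (σ.whiteArm P) ((↑(triBall (2 * P.M)) : Set (Site 2)) ∪ triRotIsoPow σ.ic '' ↑(eslotFrame P.M (σ.kc P) (σ.Tc P) P.w)) := by
  rw [determinedBy_iff]
  intro ω ω' hω
  have h : ∀ v ∈ (↑(triBall (2 * P.M)) : Set (Site 2)) ∪ triRotIsoPow σ.ic '' ↑(eslotFrame P.M (σ.kc P) (σ.Tc P) P.w),
      v ∈ ω ↔ v ∈ ω' := fun v hv => by
    constructor
    · intro hvω; have : v ∈ ω ∩ _ := ⟨hvω, hv⟩; rw [hω] at this; exact this.1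
    · intro hvω; have : v ∈ ω' ∩ _ := ⟨hvω, hv⟩; rw [← hω] at this; exact this.1
  exact ⟨whiteArm_of_agree P σ hw hk₀ hR h, whiteArm_of_agree P σ hw hk₀ hR fun v hv => (h v hv).symm⟩

/-- The framed slot box is part of the private support `Pfin`. [folklore] -/
theorem image_eslotFrame_subset_Pfin :
    triRotIsoPow σ.io '' (↑(eslotFrame P.M (σ.ko P) (σ.To P) P.w) : Set (Site 2)) ⊆ ↑(σ.Pfin P) := by
  intro v hv
  obtain ⟨u, hu, rfl⟩ := hv
  rw [Finset.mem_coe, Pfin, Finset.mem_union, Finset.mem_image]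
  exact Or.inl ⟨u, hu, rfl⟩

/-- The framed slot box of the closed tip is part of the private support `Mfin`. [folklore] -/
theorem image_eslotFrame_subset_Mfin :
    triRotIsoPow σ.ic '' (↑(eslotFrame P.M (σ.kc P) (σ.Tc P) P.w) : Set (Site 2)) ⊆ ↑(σ.Mfin P) := by
  intro v hv
  obtain ⟨u, hu, rfl⟩ := hv
  rw [Finset.mem_coe, Mfin, Finset.mem_union, Finset.mem_image]
  exact Or.inl ⟨u, hu, rfl⟩

end ESlot

end Literature.Probability.Percolation
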